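import Summits.BirchSwinnertonDyer.Rank1Residual.Additive.X4SharpThreeKimRankOneConsequences
import Literature.NumberTheory.EllipticCurves.Kim2025.LargeImageStructureOPEN
import HarnessLib

/-!
# X4 ∧ `r_an = 1` at `p = 3`: BRIDGE between the two channels of "Kim at 3, rank one" — the cited
# PREPRINT `_OPEN` fact (Kim 2025 Thm. 1.1, Literature, team row T-a4) ⟹ the Summits-side conjecture
# `X4SharpThreeKimRankOne` (team row T-a2r1) — referee 1 ruling RA3 (iii)
# (cell `b2b-bsdres`, team n1011, sub-target T-a2r1; sibling of `Additive/X4SharpThreeKimRankOne{Shape,Consequences}.lean`)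

HONEST FRAMING (cell `b2b-bsdres`, run/shared/lean/b2b/bsd-rank1-residual/, verbatim in every
file): the goal of the cell is to DELETE the COMBINATION-SHAPED residual classes of the
Birch–Swinnerton-Dyer formula for ALL analytic-rank `≤ 1` elliptic curves over `ℚ` — "full BSD
formula for every rank `≤ 1` curve in class `C`" assembled STRICTLY from published theorems — so
that the rank-`≤ 1` remainder becomes exactly the CONSTRUCTION-SHAPED classes, which are TYPED
(missing-input `Prop`s), NOT attempted. This is not "finishing BSD". Team n1011: prove what is
provable now; shrink each hard class to its core with data; no claim beyond stated classes;
research routes; census output = EVIDENCE / conjecture items, never a Literature fact. X4 stays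
CONSTRUCTION-SHAPED; nothing here is booked; §I O7 / N11 unchanged. Theorems only (no definition,
no named fact). FLAG `Kim2025-preprint` (referee 1 RA4): every theorem of this file consumes the
UNREFEREED claim `Kim2025.rankOne_card_sha_eq_one_of_kuriharaNumber_ne_zero_of_towerSurj_OPEN`
(C.-H. Kim, arXiv:2505.09121v1 Thm. 1.1, typed by team row T-a4 as an explicitly labelled OPEN
hypothesis, `[claim: Kim2025RefinedTNC, under-review]`) as an explicit hypothesis `hK25`; a
result using it is CONDITIONAL on that preprint; NEVER cite it as a theorem (cell ABSOLUTE RULE).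

## What this file proves (referee 1, REFEREE-1.md RA3 (iii): "once T-a4 lands, … APPEND a
kernel lemma … so the two channels cannot drift")

The rank-one statement "Kim 2026 Thm. 1.9 (1)(4)(6) at `p = 3`" now lives in two channels:
(a) Literature, cited PREPRINT: `Kim2025.rankOne_card_sha_eq_one_of_kuriharaNumber_ne_zero_of_towerSurj_OPEN`
(`∀ W p, 3 ≤ p → tower → L(E,1) = 0 → r_an = 1 → Ш finite → D, p ∤ c_D → period transfer →
ℓ ∈ 𝒫₁, cyclic → ψ onto → δ̃_ℓ ≠ 0 → #Ш(E/ℚ)(p) = 1`); (b) Summits, our conjecture: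
`KimRankOneUnitAt W p` / `KimThreeRankOne` / `X4SharpThreeKimRankOne` (p249591). Their binder
bodies are IDENTICAL except that (a) quantifies `p` with `3 ≤ p` and omits the redundant
`W.HasSurjectiveModNGaloisRep p →` (referee 1 RA1: both spellings canonical). Hence:
* `kimRankOneUnitAt_of_kim2025_OPEN` : (a) ∧ `3 ≤ p` ⟹ `KimRankOneUnitAt W p` (one line);
* `kimThreeRankOne_of_kim2025_OPEN` : (a) ⟹ `KimThreeRankOne`;
  `x4SharpThreeKimRankOne_of_kim2025_OPEN` : (a) ⟹ `X4SharpThreeKimRankOne` — the two channels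
  cannot drift: every consumer of the Summits conjecture is, under the preprint, a consumer of
  the cited `_OPEN` fact (the LEVEL-TWO conjecture `X4SharpThreeKimRankOneLevelTwo` has no `_OPEN`
  counterpart yet — Kim 2025 Thm. 1.1 (Str) gives `length ≤ ∂^{(1)}` just as well; T-a4 may add it);
* the O7 ∩ X4@3 census shape restated with the PREPRINT as the hypothesis:
  `X4RankOne.bsdp_three_of_kim2025_OPEN_of_cert_of_kuriharaNumber` (+ `_of_optimal_`): on
  `ClassX4 W 3` ∧ `r_an = 1` with surj(3) and a tower certificate, a datum with `3 ∤ c_D` and the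
  period transfer, ONE unit Kurihara number at a cyclic `ℓ ∈ 𝒫₁(E,3)`, `#Ш_an` a `3`-unit:
  `BSD(E,3)` — CONDITIONAL on the preprint (flag `Kim2025-preprint`), per pair, nothing booked.

Normalisation note (referee 1 RA3 (ii), KIM-AT-3-ANATOMY (γ)): the `_OPEN` fact is typed in the
tree's `Ω⁺_f`/Néron currency with the period-transfer binder, i.e. ALREADY in shape (b)'s
currency ("weaker than the announced print" per its docstring); the `Ω^±_{f,min}` ↔ `Ω⁺_f`
bridge is therefore T-a4's/T-a0's burden, not this file's, and nothing here assumes `m(E) = 0`.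

References: Kim 2025 preprint [Kim2025RefinedTNC] Thm. 1.1; Sakamoto 2024
[Sakamoto2024KolyvaginThree] Thm. 1.1; Kim 2026 [Kim2022StructureSelmer] Thm. 1.9; Miller 2011
[Miller2011LMS] Def. 1.1; cells/n1011/REFEREE-1.md RA1–RA4, ACK-1 T-a2r1 (05:20Z).
-/

noncomputable section

open scoped Classical MatrixGroups ModularForm

open CongruenceSubgroup WeierstrassCurve Literature.NumberTheory.EllipticCurves
  Literature.NumberTheory.EllipticCurves.ModularForms
  Literature.NumberTheory.EllipticCurves.Rank1Residual
  Literature.NumberTheory.EllipticCurves.Rank1Residual.Typed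

namespace Summit.BirchSwinnertonDyer.Rank1Residual.Additive

variable (W : WeierstrassCurve ℚ) [W.IsElliptic] [W.IsGloballyMinimal] (p : ℕ) [Fact p.Prime]

/-! ## §1 The cited PREPRINT `_OPEN` fact implies the Summits-side rank-one conjectures -/

/-- **Channel bridge, per pair**: the cited OPEN preprint fact (Kim 2025 Thm. 1.1, rank one, unit
Kurihara number, large image, `3 ≤ p`) implies the per-pair predicate `KimRankOneUnitAt W p` at
every `p ≥ 3` (the predicate's extra `Surj W p` binder is simply dropped). CONDITIONAL on the
preprint (flag `Kim2025-preprint`); nothing asserted about its truth.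
[cite: Kim2025RefinedTNC, Thm. 1.1 (Str) (ANNOUNCED; OPEN hypothesis)] [cite: Sakamoto2024KolyvaginThree, Thm. 1.1] -/
theorem kimRankOneUnitAt_of_kim2025_OPEN
    (hK25 : Kim2025.rankOne_card_sha_eq_one_of_kuriharaNumber_ne_zero_of_towerSurj_OPEN)
    (hp : 3 ≤ p) : KimRankOneUnitAt W p :=
  fun _ htower hL hr hfin _ _ D hc hper ℓ _ hℓ hcyc ψ hψ hδ =>
    hK25 W p hp htower hL hr hfin D hc hper ℓ hℓ hcyc ψ hψ hδ

/-- **Channel bridge, every `E/ℚ` at `3`**: the preprint fact implies `KimThreeRankOne`.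
CONDITIONAL on the preprint; so the two channels cannot drift (referee 1 RA3 (iii)).
[cite: Kim2025RefinedTNC, Thm. 1.1 (Str) (ANNOUNCED; OPEN hypothesis)] -/
theorem kimThreeRankOne_of_kim2025_OPEN
    (hK25 : Kim2025.rankOne_card_sha_eq_one_of_kuriharaNumber_ne_zero_of_towerSurj_OPEN) :
    KimThreeRankOne :=
  fun W _ _ => kimRankOneUnitAt_of_kim2025_OPEN W 3 hK25 le_rfl

/-- **Channel bridge, the O7 ∩ X4@3 hypothesis**: the preprint fact implies
`X4SharpThreeKimRankOne` (the additive restriction). CONDITIONAL on the preprint.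
[cite: Kim2025RefinedTNC, Thm. 1.1 (Str) (ANNOUNCED; OPEN hypothesis)] -/
theorem x4SharpThreeKimRankOne_of_kim2025_OPEN
    (hK25 : Kim2025.rankOne_card_sha_eq_one_of_kuriharaNumber_ne_zero_of_towerSurj_OPEN) :
    X4SharpThreeKimRankOne :=
  fun W _ _ _ => kimRankOneUnitAt_of_kim2025_OPEN W 3 hK25 le_rfl

/-! ## §2 The O7 ∩ X4@3 census shape with the PREPRINT as the hypothesis -/

/-- **O7 ∩ X4@3, unit certificate, CONDITIONAL ON THE PREPRINT** (flag `Kim2025-preprint`): on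
`ClassX4 W 3` ∧ `r_an = 1` with surj(3) and a tower certificate (`j`-witness or surj(9)), a datum
`D` with `3 ∤ c_D` and the period transfer, ONE unit Kurihara number at a cyclic `ℓ ∈ 𝒫₁(E,3)`, and
`#Ш_an = q` a `3`-unit: `BSD(E,3)` — from the cited OPEN fact `hK25` (Kim 2025 Thm. 1.1; the `p = 3`
Chebotarev step is Sakamoto 2024, refereed), GZK and modularity. Per pair; an EVIDENCE-grade
conditional closure while the preprint is unrefereed; NOT a class theorem; nothing booked.
[cite: Kim2025RefinedTNC, Thm. 1.1 (Str) (ANNOUNCED; OPEN hypothesis)] [cite: Sakamoto2024KolyvaginThree, Thm. 1.1]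
[cite: Miller2011LMS, Def. 1.1] -/
theorem X4RankOne.bsdp_three_of_kim2025_OPEN_of_cert_of_kuriharaNumber
    (hK25 : Kim2025.rankOne_card_sha_eq_one_of_kuriharaNumber_ne_zero_of_towerSurj_OPEN)
    (hGZK : rank_eq_analyticRank_of_analyticRank_le_one) (hmod : hasEntireLFunction_rat)
    (hX : ClassX4 W 3) (hsurj : Surj W 3)
    (hcert : (∃ q : ℕ, q.Prime ∧ q ≠ 3 ∧ padicValRat q W.j < 0 ∧ ¬ (3 : ℤ) ∣ padicValRat q W.j) ∨
      W.HasSurjectiveModNGaloisRep 9)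
    (hr : W.analyticRank = 1) {q : ℚ} (hq : shaAn W = (q : ℂ)) (hv : padicValRat 3 q = 0)
    {N : ℕ} [NeZero N] (D : ModularParametrizationData W N) (hc : ¬ (3 : ℤ) ∣ D.maninConstant)
    (hper : ∃ u : ℚ, ‖(u : ℚ_[3])‖ = 1 ∧ W.realPeriodRat = u * plusPeriod D.f)
    (ℓ : ℕ) [Fact ℓ.Prime] (hℓ : Kato.IsKolyvaginPrime W 3 1 ℓ)
    (hcyc : Nat.card {P : ((WeierstrassCurve.integralModelInt W).map
        (Int.castRingHom (ZMod ℓ))).toAffine.Point // 3 • P = 0} ≤ 3)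
    (ψ : (ℓ' : ℕ) → (ZMod ℓ')ˣ →* Multiplicative (ZMod (3 ^ 1)))
    (hψ : Function.Surjective (ψ ℓ)) (hδ : kuriharaNumber D.f (3 ^ 1) ℓ ψ ≠ 0) : BSDp W 3 :=
  X4RankOne.bsdp_three_of_kimShape_of_cert_of_kuriharaNumber W
    (x4SharpThreeKimRankOne_of_kim2025_OPEN hK25) hGZK hmod hX hsurj hcert hr hq hv D hc hper ℓ hℓ
    hcyc ψ hψ hδ

/-- **O7 ∩ X4@3, unit certificate, OPTIMAL datum, CONDITIONAL ON THE PREPRINT**: as above with the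
period binder discharged by optimality (`X4.periodTransfer_of_optimal`; `hopt` and `3 ∤ c_D` stay
explicit — the `|c| = 1` of Agashe–Ribet–Stein for `N ≤ 130000` is a per-row census bit, not used
silently, referee 1 ACK-1 proviso (2)). Per pair; nothing booked.
[cite: Kim2025RefinedTNC, Thm. 1.1 (Str) (ANNOUNCED; OPEN hypothesis)] [cite: CremonaAlgorithms1997, §2.8 (p. 26)]
[cite: Miller2011LMS, Def. 1.1] -/
theorem X4RankOne.bsdp_three_of_kim2025_OPEN_of_cert_of_optimal_of_kuriharaNumber
    (hK25 : Kim2025.rankOne_card_sha_eq_one_of_kuriharaNumber_ne_zero_of_towerSurj_OPEN)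
    (hGZK : rank_eq_analyticRank_of_analyticRank_le_one) (hmod : hasEntireLFunction_rat)
    (hX : ClassX4 W 3) (hsurj : Surj W 3)
    (hcert : (∃ q : ℕ, q.Prime ∧ q ≠ 3 ∧ padicValRat q W.j < 0 ∧ ¬ (3 : ℤ) ∣ padicValRat q W.j) ∨
      W.HasSurjectiveModNGaloisRep 9)
    (hr : W.analyticRank = 1) {q : ℚ} (hq : shaAn W = (q : ℂ)) (hv : padicValRat 3 q = 0)
    {N : ℕ} [NeZero N] (D : ModularParametrizationData W N)
    (hopt : ∀ z ∈ D.L.lattice, ∃ w ∈ periodLattice D.f, z = D.c * w)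
    (hc : ¬ (3 : ℤ) ∣ D.maninConstant)
    (ℓ : ℕ) [Fact ℓ.Prime] (hℓ : Kato.IsKolyvaginPrime W 3 1 ℓ)
    (hcyc : Nat.card {P : ((WeierstrassCurve.integralModelInt W).map
        (Int.castRingHom (ZMod ℓ))).toAffine.Point // 3 • P = 0} ≤ 3)
    (ψ : (ℓ' : ℕ) → (ZMod ℓ')ˣ →* Multiplicative (ZMod (3 ^ 1)))
    (hψ : Function.Surjective (ψ ℓ)) (hδ : kuriharaNumber D.f (3 ^ 1) ℓ ψ ≠ 0) : BSDp W 3 :=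
  X4RankOne.bsdp_three_of_kimShape_of_cert_of_optimal_of_kuriharaNumber W
    (x4SharpThreeKimRankOne_of_kim2025_OPEN hK25) hGZK hmod hX hsurj hcert hr hq hv D hopt hc ℓ hℓ
    hcyc ψ hψ hδ

end Summit.BirchSwinnertonDyer.Rank1Residual.Additive

end
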